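import Summits.BirchSwinnertonDyer.BirchSwinnertonDyer.Theorems.EisensteinPrimesMazurMCOnX1RankZeroInterludeSelmerIsogenyMaps
import Literature.NumberTheory.EllipticCurves.IwasawaAlgebraProofs
import Literature.NumberTheory.EllipticCurves.IwasawaAlgebraMuAdditiveProofs
import Literature.NumberTheory.EllipticCurves.IwasawaEulerCharDualityProofs
import Literature.NumberTheory.EllipticCurves.KatoDivisibilityColemanKernelSkeletonProofs
import Literature.NumberTheory.EllipticCurves.IwasawaAlgebraMuQuotientProofs
import Summits.BirchSwinnertonDyer.BirchSwinnertonDyer.Theorems.KatoDescentPotSupersingularMemberHullRankOne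
import HarnessLib

/-!
# Crux `MazurMCOnX1RankZero` (item stmt-BirchSwinnertonDyer-19035), line `interlude_with_torsion`, road B (B1):
# `μ` IS MONOTONE ALONG `Λ`-LINEAR MAPS WITH FINITE COKERNEL, and finite `ker Sel(f)` ⟹ finite `coker ᵗSel(f)`

Cell `bsd-eis` (host `run/shared/lean/pub/bsd-eis/`), LEAD `cruxlead-19035` (g0); `--supports`
stmt-BirchSwinnertonDyer-19035 as a HELPER. Content = sections `RoadBAlgebra`, `RoadBDual` and the abstract join
`charIdeal_eq_of_lengthAt_eq_of_mu_eq` of the bsd-idea-11 supplement line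
`Cruxes/MazurMCOnX1RankZero/Lines/interlude_stepsTwoThree_split_idea11g6.lean` (REV 8.1, mathematics by seat bsd-idea-11
g15, kernel-checked there), moved verbatim into the tree. Commutative algebra over `Λ = ℤ_p⟦T⟧` and Pontryagin duality;
UNCONDITIONAL; NOTHING is asserted about BSD, Mazur's main conjecture or IMC2.

WHAT. (i) A finite `Λ`-module has `μ = 0` (torsion: tree `MemberHullRankOne.isTorsion_of_finite`; `μ` along surjections: tree
`muInvariant_le_of_surjective`); an extension of a finite module by a quotient of a torsion module is torsion; hence **`μ(X) ≤ μ(Y)` along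
a `Λ`-linear `g : Y → X` with `X ⧸ g(Y)` finite** (`roadB_muInvariant_le_of_finite_coker`), and equality when such maps
exist both ways. (ii) If `Sel_𝔭^Σ(f) : Sel(E) → Sel(E')` (`K2e.acSelmerMap`) has finite kernel then its `Λ`-linear
transpose has finite cokernel (`K2e.finite_coker_transpose_of_finite_ker`: a character killing `ker Sel(f)` factors through
`Sel(E)/ker ↪ Sel(E')` and extends because `ℚ/ℤ` is injective), so **`ker Sel(f)` finite ⟹ `𝔛(E)` torsion and
`μ(𝔛(E)) ≤ μ(𝔛(E'))`** (`K2e.muInvariant_le_of_finite_ker`). (iii) Two `Λ`-modules with equal local lengths at every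
height-one `𝔮 ≠ (p)` and equal `μ` have equal `Module.charIdeal` (`charIdeal_eq_of_lengthAt_eq_of_mu_eq`).
References: Greenberg, LNM 1716 §5 (Remark after Cor. 5.5; proof of Prop. 5.10); Washington §13.2; Bourbaki AC VII §4.5.
-/

set_option linter.dupNamespace false
set_option autoImplicit false

noncomputable section

open scoped Classical

open WeierstrassCurve NumberField IsDedekindDomain Field
  Literature.NumberTheory.EllipticCurves Literature.NumberTheory.GaloisRepresentations
  Literature.NumberTheory.EllipticCurves.Castella2018

namespace Summit.BirchSwinnertonDyer.BirchSwinnertonDyer.Theorems.InterludeWithTorsion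

section RoadBAlgebra
/-! ### Road B (B1), the `Λ`-module half: `μ` is monotone along maps with finite cokernel -/

variable {p : ℕ} [Fact p.Prime]

/-- `μ` of a finite `Λ`-module vanishes: a finite `M` is finitely generated over `ℤ_p` (scalars restricted
along `ℤ_p → Λ`), so its localisation at the height-one prime `(p)` is zero (`lengthAt_eq_zero_of_finite`,
Cayley–Hamilton). [cite: Washington1997, §13.2] -/
theorem roadB_muInvariant_eq_zero_of_finite {M : Type*} [AddCommGroup M]
    [Module (IwasawaAlgebra p) M] [Finite M] : muInvariant p M = 0 := by
  letI : Module ℤ_[p] M := Module.compHom M (algebraMap ℤ_[p] (IwasawaAlgebra p))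
  haveI : IsScalarTower ℤ_[p] (IwasawaAlgebra p) M :=
    IsScalarTower.of_algebraMap_smul fun _ _ => rfl
  haveI : Module.Finite ℤ_[p] M := Module.Finite.of_finite
  let 𝔭 : PrimeSpectrum (IwasawaAlgebra p) :=
    ⟨IwasawaAlgebra.augIdealP p, IwasawaAlgebra.isPrime_augIdealP_holds p⟩
  rw [Literature.NumberTheory.EllipticCurves.muInvariant_eq_toNat_lengthAt p M 𝔭 rfl,
    lengthAt_eq_zero_of_finite p M 𝔭 rfl]
  rfl

/-- ROAD B, step (B1), the `Λ`-module half — **an extension of a finite module by a quotient of a torsion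
module is torsion**: if `g : Y → X` is `Λ`-linear with finite cokernel and `Y` is torsion then `X` is torsion
(`b • x ∈ g(Y)` for some `b ≠ 0` since `X ⧸ g(Y)` is finite, then `a • y = 0` for a preimage `y`).
[cite: BourbakiAC5to7, Ch. VII §4.5] [folklore] -/
theorem roadB_isTorsion_of_finite_coker {X Y : Type*} [AddCommGroup X] [Module (IwasawaAlgebra p) X]
    [AddCommGroup Y] [Module (IwasawaAlgebra p) Y] (hY : Module.IsTorsion (IwasawaAlgebra p) Y)
    (g : Y →ₗ[IwasawaAlgebra p] X) (hcoker : Finite (X ⧸ LinearMap.range g)) :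
    Module.IsTorsion (IwasawaAlgebra p) X := by
  intro x
  obtain ⟨⟨b, hb⟩, hbx⟩ :=
    @Summit.BirchSwinnertonDyer.BirchSwinnertonDyer.Theorems.MemberHullRankOne.isTorsion_of_finite p _
      (X ⧸ LinearMap.range g) _ _ hcoker (Submodule.Quotient.mk x)
  have hmem : b • x ∈ LinearMap.range g := by
    rw [← Submodule.Quotient.mk_eq_zero, Submodule.Quotient.mk_smul]
    rw [Submonoid.mk_smul] at hbx
    exact hbx
  obtain ⟨y, hy⟩ := LinearMap.mem_range.mp hmem
  obtain ⟨⟨a, ha⟩, hay⟩ := @hY y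
  refine ⟨⟨a * b, mul_mem ha hb⟩, ?_⟩
  rw [Submonoid.mk_smul, mul_smul, ← hy, ← map_smul]
  rw [Submonoid.mk_smul] at hay
  rw [hay, map_zero]

/-- ROAD B, step (B1), the `Λ`-module half — **`μ` is monotone along a `Λ`-linear map with finite cokernel**:
for finitely generated `Λ`-modules `X`, `Y` with `Y` torsion and `g : Y → X` with `X ⧸ g(Y)` finite,
`μ(X) ≤ μ(Y)` (additivity `μ(X) = μ(g Y) + μ(X ⧸ g Y)`, `μ(finite) = 0`, and `μ(g Y) ≤ μ(Y)` along the
surjection `Y ↠ g Y`). In (B1) this is applied to the Pontryagin dual `g = (φ_*)^∨ : 𝔛_Gr(B) → 𝔛_Gr(A)` of the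
Selmer map of an isogeny `φ : A → B` whose kernel `ker φ_*` is finite (`coker g = (ker φ_*)^∨`), giving
`μ(𝔛_Gr(A)) ≤ μ(𝔛_Gr(B))`. [cite: GreenbergLNM1716, §5, Remark after Cor. 5.5 («both λ and μ are additive»)]
[folklore] -/
theorem roadB_muInvariant_le_of_finite_coker {X Y : Type*} [AddCommGroup X]
    [Module (IwasawaAlgebra p) X] [AddCommGroup Y] [Module (IwasawaAlgebra p) Y]
    [Module.Finite (IwasawaAlgebra p) X] [Module.Finite (IwasawaAlgebra p) Y]
    (hY : Module.IsTorsion (IwasawaAlgebra p) Y) (g : Y →ₗ[IwasawaAlgebra p] X)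
    (hcoker : Finite (X ⧸ LinearMap.range g)) :
    muInvariant p X ≤ muInvariant p Y := by
  have hX : Module.IsTorsion (IwasawaAlgebra p) X := roadB_isTorsion_of_finite_coker hY g hcoker
  have hadd : muInvariant p X =
      muInvariant p (LinearMap.range g) + muInvariant p (X ⧸ LinearMap.range g) :=
    muInvariant_add_of_shortExact_holds p X hX (LinearMap.range g).subtype (LinearMap.range g).mkQ
      (Submodule.subtype_injective _) (Submodule.mkQ_surjective _) (LinearMap.exact_subtype_mkQ _)
  have h0 : muInvariant p (X ⧸ LinearMap.range g) = 0 := roadB_muInvariant_eq_zero_of_finite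
  have hle : muInvariant p (LinearMap.range g) ≤ muInvariant p Y :=
    Literature.NumberTheory.EllipticCurves.muInvariant_le_of_surjective hY g.rangeRestrict
      (LinearMap.surjective_rangeRestrict g)
  rw [hadd, h0, add_zero]
  exact hle

/-- ROAD B, step (B1), symmetric form: `Λ`-linear maps with finite cokernel in BOTH directions between finitely
generated `Λ`-modules, one of them torsion, force both torsion and EQUAL `μ` — apply
`roadB_muInvariant_le_of_finite_coker` to `(φ_*)^∨` and `(φ̂_*)^∨`; this is the shape of the conclusion of
`XGrMuIsogenyInvariantCyc`. [folklore] -/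
theorem roadB_muInvariant_eq_of_finite_coker {X Y : Type*} [AddCommGroup X]
    [Module (IwasawaAlgebra p) X] [AddCommGroup Y] [Module (IwasawaAlgebra p) Y]
    [Module.Finite (IwasawaAlgebra p) X] [Module.Finite (IwasawaAlgebra p) Y]
    (hY : Module.IsTorsion (IwasawaAlgebra p) Y) (g : Y →ₗ[IwasawaAlgebra p] X)
    (hcoker : Finite (X ⧸ LinearMap.range g)) (g' : X →ₗ[IwasawaAlgebra p] Y)
    (hcoker' : Finite (Y ⧸ LinearMap.range g')) :
    Module.IsTorsion (IwasawaAlgebra p) X ∧ muInvariant p X = muInvariant p Y := by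
  have hX : Module.IsTorsion (IwasawaAlgebra p) X := roadB_isTorsion_of_finite_coker hY g hcoker
  exact ⟨hX, le_antisymm (roadB_muInvariant_le_of_finite_coker hY g hcoker)
    (roadB_muInvariant_le_of_finite_coker hX g' hcoker')⟩

end RoadBAlgebra

section RoadBDual
/-! ### Road B (B1), the duality half: finite kernel of `Sel(f)` ⟹ finite cokernel of `ᵗSel(f)` -/

/-- Characters modulo a subgroup containing every character that kills `ker φ`: if `φ : A → B` has finite
kernel and `R` contains every character of `A` vanishing on `ker φ`, then `Hom(A, ℚ/ℤ) ⧸ R` is finite (it is a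
quotient of `Hom(A, ℚ/ℤ) ⧸ ker(res) ≅ res(Hom(A, ℚ/ℤ)) ⊂ Hom(ker φ, ℚ/ℤ)`, a finite group). [folklore] -/
theorem roadB_finite_quotient_characters {A B : Type*} [AddCommGroup A] [AddCommGroup B] (φ : A →+ B)
    (hker : Finite φ.ker) (R : AddSubgroup (A →+ AddCircle (1 : ℚ)))
    (hR : ∀ x : A →+ AddCircle (1 : ℚ), (∀ a ∈ φ.ker, x a = 0) → x ∈ R) :
    Finite ((A →+ AddCircle (1 : ℚ)) ⧸ R) := by
  let res : (A →+ AddCircle (1 : ℚ)) →+ (φ.ker →+ AddCircle (1 : ℚ)) :=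
    AddMonoidHom.mk' (fun x => x.comp φ.ker.subtype) fun x y => rfl
  haveI : Finite (φ.ker →+ AddCircle (1 : ℚ)) := PontryaginCard.finite_characterModule_of_finite φ.ker
  haveI : Finite ((A →+ AddCircle (1 : ℚ)) ⧸ res.ker) :=
    Finite.of_equiv _ (QuotientAddGroup.quotientKerEquivRange res).symm.toEquiv
  haveI : res.ker.FiniteIndex := AddSubgroup.finiteIndex_of_finite_quotient
  have hle : res.ker ≤ R := by
    intro x hx
    refine hR x fun a ha => ?_
    have := DFunLike.congr_fun (AddMonoidHom.mem_ker.mp hx) ⟨a, ha⟩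
    simpa [res] using this
  haveI : R.FiniteIndex := AddSubgroup.finiteIndex_of_le hle
  exact AddSubgroup.finite_quotient_of_finiteIndex

namespace K2e

open IsogenySelmerInfty GreenbergSelmer AcSelmer

variable {K : Type} [Field K] [NumberField K] {W W' : WeierstrassCurve K} (p : ℕ) [Fact p.Prime]
  (κ : ZpExtension K p) (𝔭 : HeightOneSpectrum (𝓞 K)) (S : Set (HeightOneSpectrum (𝓞 K)))
  (γ : absoluteGaloisGroup K) [Fact (κ.IsTopGenerator γ)]

/-- **A character of `Sel_𝔭^Σ(E)` that kills `ker Sel(f)` is a transposed character of `Sel_𝔭^Σ(E')`**: it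
factors through `Sel(E)/ker ↪ Sel(E')` (`QuotientAddGroup.kerLift`) and extends to `Sel(E')` because `ℚ/ℤ` is
injective (`CharacterModule.dual_surjective_of_injective`). [folklore] -/
theorem mem_range_transpose_of_forall_ker (f : W.geomPoints →+ W'.geomPoints)
    (hf : ∀ (σ : absoluteGaloisGroup K) (P : W.geomPoints), f (σ • P) = σ • f P)
    (F : XAc W' p κ 𝔭 S γ →ₗ[IwasawaAlgebra p] XAc W p κ 𝔭 S γ)
    (hF : ∀ (x : XAc W' p κ 𝔭 S γ) (s : selmerAc W p κ 𝔭 S), F x s = x (acSelmerMap p κ 𝔭 S f hf s))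
    (x : XAc W p κ 𝔭 S γ) (hx : ∀ s ∈ (acSelmerMap p κ 𝔭 S f hf).ker, x s = 0) :
    x ∈ LinearMap.range F := by
  set φ := acSelmerMap p κ 𝔭 S f hf with hφ
  -- `x` as a character of `Sel(E) ⧸ ker φ`
  let xbar : selmerAc W p κ 𝔭 S ⧸ φ.ker →+ AddCircle (1 : ℚ) :=
    QuotientAddGroup.lift φ.ker (x : selmerAc W p κ 𝔭 S →+ AddCircle (1 : ℚ)) fun s hs => hx s hs
  -- the injection `Sel(E) ⧸ ker φ ↪ Sel(E')`, as a `ℤ`-linear map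
  let ι : (selmerAc W p κ 𝔭 S ⧸ φ.ker) →ₗ[ℤ] selmerAc W' p κ 𝔭 S :=
    (QuotientAddGroup.kerLift φ).toIntLinearMap
  have hι : Function.Injective ι := QuotientAddGroup.kerLift_injective φ
  obtain ⟨x', hx'⟩ := CharacterModule.dual_surjective_of_injective ι hι xbar
  refine LinearMap.mem_range.mpr ⟨x', ?_⟩
  refine DFunLike.ext _ _ fun s => ?_
  rw [hF]
  have h1 : (x' : selmerAc W' p κ 𝔭 S →+ AddCircle (1 : ℚ)) (φ s) = xbar (QuotientAddGroup.mk s) := by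
    rw [← hx']
    rfl
  exact h1

/-- **ROAD B (B1), duality half (PROVED)**: if `Sel_𝔭^Σ(f) : Sel(E) → Sel(E')` has finite kernel then the
`Λ`-linear transpose `ᵗSel(f) : 𝔛(E') → 𝔛(E)` has finite cokernel. Combined with
`roadB_muInvariant_le_of_finite_coker`: `ker Sel(f)` finite ⟹ `μ(𝔛(E)) ≤ μ(𝔛(E'))` (given `𝔛(E')` f.g. torsion,
`𝔛(E)` f.g.). [cite: GreenbergLNM1716, §5, proof of Prop. 5.10] [folklore] -/
theorem finite_coker_transpose_of_finite_ker (f : W.geomPoints →+ W'.geomPoints)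
    (hf : ∀ (σ : absoluteGaloisGroup K) (P : W.geomPoints), f (σ • P) = σ • f P)
    (F : XAc W' p κ 𝔭 S γ →ₗ[IwasawaAlgebra p] XAc W p κ 𝔭 S γ)
    (hF : ∀ (x : XAc W' p κ 𝔭 S γ) (s : selmerAc W p κ 𝔭 S), F x s = x (acSelmerMap p κ 𝔭 S f hf s))
    (hker : Finite (acSelmerMap p κ 𝔭 S f hf).ker) :
    Finite (XAc W p κ 𝔭 S γ ⧸ LinearMap.range F) :=
  roadB_finite_quotient_characters (acSelmerMap p κ 𝔭 S f hf) hker (LinearMap.range F).toAddSubgroup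
    fun x hx => mem_range_transpose_of_forall_ker p κ 𝔭 S γ f hf F hF x hx

/-- **ROAD B (B1), both halves joined (PROVED)**: along `f : E → E'` with `ker Sel_𝔭^Σ(f)` finite,
`μ(𝔛(E)) ≤ μ(𝔛(E'))` whenever `𝔛(E')` is finitely generated torsion and `𝔛(E)` finitely generated (for
`Σ` finite both are f.g.: `AcSelmer.XAc.module_finite`). What remains of (B1) for the owed `roadB_bridge` is the
GALOIS-COHOMOLOGICAL statement «`R^Σ(C)` finite ⟹ `ker Sel(f)` finite». [cite: GreenbergLNM1716, §5, proof of Prop. 5.10]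
[folklore] -/
theorem muInvariant_le_of_finite_ker (f : W.geomPoints →+ W'.geomPoints)
    (hf : ∀ (σ : absoluteGaloisGroup K) (P : W.geomPoints), f (σ • P) = σ • f P)
    [Module.Finite (IwasawaAlgebra p) (XAc W p κ 𝔭 S γ)]
    [Module.Finite (IwasawaAlgebra p) (XAc W' p κ 𝔭 S γ)]
    (htors : Module.IsTorsion (IwasawaAlgebra p) (XAc W' p κ 𝔭 S γ))
    (hker : Finite (acSelmerMap p κ 𝔭 S f hf).ker) :
    Module.IsTorsion (IwasawaAlgebra p) (XAc W p κ 𝔭 S γ) ∧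
      muInvariant p (XAc W p κ 𝔭 S γ) ≤ muInvariant p (XAc W' p κ 𝔭 S γ) := by
  obtain ⟨F, hF⟩ := exists_transpose p κ 𝔭 S γ f hf
  have hcoker := finite_coker_transpose_of_finite_ker p κ 𝔭 S γ f hf F hF hker
  exact ⟨roadB_isTorsion_of_finite_coker htors F hcoker,
    roadB_muInvariant_le_of_finite_coker htors F hcoker⟩

end K2e

end RoadBDual

/-! ### The abstract join behind K2⁺ = K2⁺-e ⊕ K2⁺-μ -/

/-- **The abstract join behind K2⁺ = K2⁺-e ⊕ K2⁺-μ (PROVED)**: two `Λ`-modules with the same local length at every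
height-one prime `𝔮 ≠ (p)` and the same `μ` have the same `Module.charIdeal` — the `finprod` over height-one
primes agrees factor by factor (at `𝔮 = (p)` the exponent is `μ`, `muInvariant_eq_toNat_lengthAt`).
[cite: Washington1997, §13.2] -/
theorem charIdeal_eq_of_lengthAt_eq_of_mu_eq (p : ℕ) [Fact p.Prime] (M N : Type*) [AddCommGroup M]
    [Module (IwasawaAlgebra p) M] [AddCommGroup N] [Module (IwasawaAlgebra p) N]
    (he : ∀ 𝔮 : PrimeSpectrum (IwasawaAlgebra p), 𝔮.asIdeal.height = 1 →
      𝔮.asIdeal ≠ IwasawaAlgebra.augIdealP p →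
      Literature.NumberTheory.EllipticCurves.Module.lengthAt (IwasawaAlgebra p) M 𝔮 =
        Literature.NumberTheory.EllipticCurves.Module.lengthAt (IwasawaAlgebra p) N 𝔮)
    (hμ : muInvariant p M = muInvariant p N) :
    Literature.NumberTheory.EllipticCurves.Module.charIdeal (IwasawaAlgebra p) M =
      Literature.NumberTheory.EllipticCurves.Module.charIdeal (IwasawaAlgebra p) N := by
  unfold Module.charIdeal
  refine finprod_mem_congr rfl fun 𝔮 h𝔮 => ?_
  by_cases hq : 𝔮.asIdeal = IwasawaAlgebra.augIdealP p
  · rw [← muInvariant_eq_toNat_lengthAt p M 𝔮 hq, ← muInvariant_eq_toNat_lengthAt p N 𝔮 hq, hμ]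
  · rw [he 𝔮 h𝔮 hq]

end Summit.BirchSwinnertonDyer.BirchSwinnertonDyer.Theorems.InterludeWithTorsion

end
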